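import Summits.CriticalPhenomena.PercolationContinuityZ3.Theorems.PercNearOneGluingNoHeavyLowerTailSunflowerMultiPetalSlackPatterns
import HarnessLib
import HarnessLib.Audit

/-!
# `NoHeavyLowerTail` (crux stmt-CriticalPhenomena-4575), abstract sunflower cubic, `k` petals: THEOREM T — three petals force STRICT antipodal Gladkov
# on the full cube (`Σ_S kkK (lab S) (lab Sᶜ) ≥ 2`), via RIGIDITY (no cover, no positive-gap configuration) and the Γ/Δ trace calculus

Support file (seat `prim-l12-p2` gen 31; `--supports stmt-CriticalPhenomena-4575`; companion of `…SunflowerMultiPetalSlackExpansion` (p364652) and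
`…SunflowerMultiPetalSlackPatterns` (the cover lemma and the three pattern lemmas)).  Everything here is PROVED: no `sorry`, no named facts, no conjecture;
the `Prop`-valued `IsPetalK`, `MSunflower.Rigid`, `MSunflower.Gam`, `MSunflower.Del` are local predicates of this work, not cited results.
Memo (prose proof, census): run/shared/lean/prim/prim-l12/prim-l12-p2/FINDING-g31-TOPCUBE-STRICTNESS.md §1.

**THEOREM T** (`MSunflower.two_le_slackTop_of_three_petals`, `…_of_three_nonempty_petals`; this work).  For every monotone map `2^α → M_k` in which three
pairwise different petal labels are attained, `2 ≤ slackTop`, i.e. `#{S black with white complement} ≥ 1 + #{complementary pairs carrying two different petals}`: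
Gladkov's antipodal inequality (p339016 `antipodal_gladkov` = `0 ≤ slackTop`) is STRICT.  With two petals `slackTop = 0` occurs (87 of the two-component structures
on ≤ 4 points).  In the slot form `ZK = 3·SwK [decided] − NtriK` every decided spectator whose cube still sees three petals therefore supplies ≥ 1.
PROOF (memo §1.2–1.3).  `slackTop < 2` makes the structure RIGID (`rigid_of_slackTop_lt`: contrapositives of the cover lemma and of the three pattern lemmas).
In a rigid structure put `Γ(e) ∋ p` (`Gam e p`: a white set enters label `p` at `e`) and `Δ(e) ∋ p` (`Del e p`: a `p`-set turns black at `e`); rigidity gives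
|Γ(e)|, |Δ(e)| ≤ 1 and Γ(e) ∩ Δ(e) = ∅ (`Gam_unique`, `Del_unique`, `Gam_Del_disjoint`), so a petal class is closed under toggling every coordinate outside
`E_p := {e : p ∈ Γ(e) ∪ Δ(e)}` (`lab_insert_of_not_Del`, `lab_erase_of_not_Gam`, `lab_union_of_not_Del`, `lab_sdiff_of_not_Gam`, `lab_inter_Epet`, `lab_union_compl_Epet`);
hence CROSS-INCOMPARABILITY (`not_inter_Epet_subset`: for a `p`-set `S` and a `q`-set `T`, `S ∩ E_p ∩ E_q ⊄ T`, by `lab_mono`), three-way exclusion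
(`not_mem_Epet_third`) and the J-set lemma (`exists_mem_Gam`: every `b`-set contains a point of `E_b ∩ E_c` with `b ∈ Γ`).  Main argument (`false_of_rigid_Del`): for
`e ∈ E_a` with `b ∈ Δ(e)` take a cardinality-minimal black `M₀ ⊆ T'+e`; `S := M₀ ∖ e` is a `b`-set (no cover); for the point `x ∈ S ∩ E_b ∩ E_c` with `b ∈ Γ(x)` the lower
cover `M₀ ∖ x` is grey of some petal `d`; `d = a` and `d ∉ {a,b}` contradict cross-incomparability, `d = b` puts `b ∈ Δ(x) ∩ Γ(x)`.  ∎
-/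

namespace Summit.CriticalPhenomena.PercolationContinuityZ3.Theorems.SunflowerPartition

open Finset

variable {α : Type*} [DecidableEq α]

/-- A label value in `Fin (k+2)` is a PETAL value: neither bottom `0` nor top `Fin.last (k+1)`. [this work] -/
structure IsPetalK (k : ℕ) (p : Fin (k + 2)) : Prop where
  /-- not the bottom label -/
  ne_zero : p ≠ 0
  /-- not the top label -/
  ne_last : p ≠ Fin.last (k + 1)

namespace MSunflower

variable {k : ℕ} (F : MSunflower k α)

/-! ### Γ, Δ and the rigid regime -/

/-- The RIGID regime (memo §1.2): no cover and none of the three positive-gap patterns — the contrapositives of the cover and pattern lemmas. [this work] -/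
structure Rigid (F : MSunflower k α) : Prop where
  /-- (R0) no white set has a black upper cover -/
  noCover : ∀ (Y : Finset α) (v : α), v ∉ Y → F.lab Y = 0 → F.lab (insert v Y) ≠ Fin.last (k + 1)
  /-- (R1) no two grey sets of different petals are both completed to black by the same outside coordinate -/
  noTwoBlack : ∀ (X Y : Finset α) (e : α), e ∉ X → e ∉ Y →
    F.lab X ≠ 0 → F.lab X ≠ Fin.last (k + 1) → F.lab Y ≠ 0 → F.lab Y ≠ Fin.last (k + 1) → F.lab X ≠ F.lab Y →
    F.lab (insert e X) = Fin.last (k + 1) → F.lab (insert e Y) ≠ Fin.last (k + 1)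
  /-- (R2) no two white sets enter two different petals at the same coordinate -/
  noTwoWhite : ∀ (X Y : Finset α) (e : α), e ∉ X → e ∉ Y → F.lab X = 0 → F.lab Y = 0 →
    F.lab (insert e X) ≠ 0 → F.lab (insert e X) ≠ Fin.last (k + 1) →
    F.lab (insert e Y) ≠ 0 → F.lab (insert e Y) ≠ Fin.last (k + 1) → F.lab (insert e X) = F.lab (insert e Y)
  /-- (R3) no coordinate both lets a white set enter a petal and lets a set of that petal leave to black -/
  noEnterLeave : ∀ (X Y : Finset α) (e : α), e ∉ X → e ∉ Y → F.lab X = 0 →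
    F.lab (insert e X) ≠ 0 → F.lab (insert e X) ≠ Fin.last (k + 1) → F.lab Y = F.lab (insert e X) →
    F.lab (insert e Y) ≠ Fin.last (k + 1)

/-- `Gam e p` (the memo's `p ∈ Γ(e)`): some white set not containing `e` enters label `p` when `e` is added. [this work] -/
def Gam (e : α) (p : Fin (k + 2)) : Prop := ∃ X : Finset α, e ∉ X ∧ F.lab X = 0 ∧ F.lab (insert e X) = p

/-- `Del e p` (the memo's `p ∈ Δ(e)`): some set of label `p` not containing `e` becomes black when `e` is added. [this work] -/
def Del (e : α) (p : Fin (k + 2)) : Prop := ∃ S : Finset α, e ∉ S ∧ F.lab S = p ∧ F.lab (insert e S) = Fin.last (k + 1)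

variable {F}

/-- Under `NoTwoWhite`, `Γ(e)` contains at most one petal. [this work] -/
theorem Gam_unique (hr : F.Rigid) {e : α} {p q : Fin (k + 2)} (hp : IsPetalK k p) (hq : IsPetalK k q)
    (h1 : F.Gam e p) (h2 : F.Gam e q) : p = q := by
  obtain ⟨X, heX, hX, hXe⟩ := h1
  obtain ⟨Y, heY, hY, hYe⟩ := h2
  have := hr.noTwoWhite X Y e heX heY hX hY (hXe ▸ hp.1) (hXe ▸ hp.2) (hYe ▸ hq.1) (hYe ▸ hq.2)
  rw [hXe, hYe] at this
  exact this

/-- Under `NoTwoBlack`, `Δ(e)` contains at most one petal. [this work] -/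
theorem Del_unique (hr : F.Rigid) {e : α} {p q : Fin (k + 2)} (hp : IsPetalK k p) (hq : IsPetalK k q)
    (h1 : F.Del e p) (h2 : F.Del e q) : p = q := by
  obtain ⟨X, heX, hX, hXe⟩ := h1
  obtain ⟨Y, heY, hY, hYe⟩ := h2
  by_contra hpq
  exact hr.noTwoBlack X Y e heX heY (hX ▸ hp.1) (hX ▸ hp.2) (hY ▸ hq.1) (hY ▸ hq.2) (by rw [hX, hY]; exact hpq) hXe hYe

/-- Under `NoEnterLeave`, `Γ(e)` and `Δ(e)` are disjoint. [this work] -/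
theorem Gam_Del_disjoint (hr : F.Rigid) {e : α} {p : Fin (k + 2)} (hp : IsPetalK k p)
    (h1 : F.Gam e p) (h2 : F.Del e p) : False := by
  obtain ⟨X, heX, hX, hXe⟩ := h1
  obtain ⟨Y, heY, hY, hYe⟩ := h2
  exact hr.noEnterLeave X Y e heX heY hX (hXe ▸ hp.1) (hXe ▸ hp.2) (by rw [hXe, hY]) hYe

/-! ### Single toggles -/

/-- A set of petal `p` not containing `e`, with `p ∉ Δ(e)`: adding `e` keeps the petal. [this work] -/
theorem lab_insert_of_not_Del {e : α} {p : Fin (k + 2)} (hp : IsPetalK k p) (hD : ¬ F.Del e p)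
    {S : Finset α} (he : e ∉ S) (hS : F.lab S = p) : F.lab (insert e S) = p := by
  rcases F.lab_mono (subset_insert e S) with h | h | h
  · rw [← h, hS]
  · exact absurd (hS ▸ h) hp.1
  · exact absurd ⟨S, he, hS, h⟩ hD

/-- A set of petal `p` containing `e`, with `p ∉ Γ(e)`: removing `e` keeps the petal. [this work] -/
theorem lab_erase_of_not_Gam {e : α} {p : Fin (k + 2)} (hp : IsPetalK k p) (hG : ¬ F.Gam e p)
    {S : Finset α} (he : e ∈ S) (hS : F.lab S = p) : F.lab (S.erase e) = p := by
  rcases F.lab_mono (erase_subset e S) with h | h | h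
  · rw [h, hS]
  · exact absurd ⟨S.erase e, notMem_erase e S, h, by rw [insert_erase he, hS]⟩ hG
  · exact absurd (hS ▸ h) hp.2

/-- Iterated insertion of coordinates none of which completes petal `p` to black. [this work] -/
theorem lab_union_of_not_Del {p : Fin (k + 2)} (hp : IsPetalK k p) (D : Finset α) :
    ∀ S : Finset α, (∀ e ∈ D, ¬ F.Del e p) → F.lab S = p → F.lab (S ∪ D) = p := by
  induction D using Finset.induction_on with
  | empty => intro S _ hS; rw [union_empty, hS]
  | insert f D' hf ih =>
    intro S hD hS
    have h1 : F.lab (S ∪ D') = p := ih S (fun e he => hD e (mem_insert_of_mem he)) hS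
    rw [union_insert]
    by_cases hfS : f ∈ S ∪ D'
    · rw [insert_eq_of_mem hfS, h1]
    · exact F.lab_insert_of_not_Del hp (hD f (mem_insert_self f D')) hfS h1

/-- Iterated erasure of coordinates none of which creates petal `p` from white. [this work] -/
theorem lab_sdiff_of_not_Gam {p : Fin (k + 2)} (hp : IsPetalK k p) (D : Finset α) :
    ∀ S : Finset α, (∀ e ∈ D, ¬ F.Gam e p) → F.lab S = p → F.lab (S \ D) = p := by
  induction D using Finset.induction_on with
  | empty => intro S _ hS; rw [sdiff_empty, hS]
  | insert f D' hf ih =>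
    intro S hD hS
    have h1 : F.lab (S \ D') = p := ih S (fun e he => hD e (mem_insert_of_mem he)) hS
    rw [sdiff_insert]
    by_cases hfS : f ∈ S \ D'
    · exact F.lab_erase_of_not_Gam hp (hD f (mem_insert_self f D')) hfS h1
    · rw [erase_eq_self.2 hfS]; exact h1

variable [Fintype α]

/-- **A structure whose top cube has slack `< 2` is rigid** (contrapositives of the cover lemma and the three pattern lemmas). [this work] -/
theorem rigid_of_slackTop_lt (h : F.slackTop < 2) : F.Rigid where
  noCover := fun _ _ hv hY hYv => absurd (F.two_le_slackTop_of_cover hv hY hYv) (not_le.2 h)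
  noTwoBlack := fun _ _ _ heX heY hX0 hXt hY0 hYt hXY hXe hYe =>
    absurd (F.two_le_slackTop_of_two_black_covers heX heY hX0 hXt hY0 hYt hXY hXe hYe) (not_le.2 h)
  noTwoWhite := by
    intro X Y e heX heY hX hY hXe0 hXet hYe0 hYet
    by_contra hne
    exact absurd (F.two_le_slackTop_of_two_white_lower_covers heX heY hX hY hXe0 hXet hYe0 hYet hne) (not_le.2 h)
  noEnterLeave := fun _ _ _ heX heY hX hXe0 hXet hY hYe =>
    absurd (F.two_le_slackTop_of_enter_and_leave heX heY hX hXe0 hXet hY hYe) (not_le.2 h)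

/-! ### The sets `E_p` and cross-incomparability of traces -/

/-- `E_p`: the coordinates at which petal `p` is created from white or completed to black. [this work] -/
noncomputable def Epet (F : MSunflower k α) (p : Fin (k + 2)) : Finset α := by
  classical exact univ.filter fun e => F.Gam e p ∨ F.Del e p

/-- Membership in `E_p`. [this work] -/
theorem mem_Epet {p : Fin (k + 2)} {e : α} : e ∈ F.Epet p ↔ F.Gam e p ∨ F.Del e p := by
  classical
  unfold Epet
  simp

/-- The trace on `E_p` of a `p`-set is a `p`-set. [this work] -/
theorem lab_inter_Epet {p : Fin (k + 2)} (hp : IsPetalK k p) {S : Finset α} (hS : F.lab S = p) :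
    F.lab (S ∩ F.Epet p) = p := by
  have h := F.lab_sdiff_of_not_Gam hp (S \ F.Epet p) S (fun e he hG => ?_) hS
  · have e1 : S \ (S \ F.Epet p) = S ∩ F.Epet p := by
      ext x; simp only [mem_sdiff, mem_inter, not_and, not_not]; tauto
    rwa [e1] at h
  · rw [mem_sdiff, F.mem_Epet, not_or] at he
    exact he.2.1 hG

/-- Filling a `q`-set outside `E_q` keeps a `q`-set. [this work] -/
theorem lab_union_compl_Epet {q : Fin (k + 2)} (hq : IsPetalK k q) {T : Finset α} (hT : F.lab T = q) :
    F.lab (T ∪ (univ \ F.Epet q)) = q := by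
  refine F.lab_union_of_not_Del hq (univ \ F.Epet q) T (fun e he hD => ?_) hT
  rw [mem_sdiff, F.mem_Epet, not_or] at he
  exact he.2.2 hD

/-- **Cross-incomparability** (memo (R2)): for a `p`-set `S` and a `q`-set `T` (`p ≠ q` petals) the trace of `S` on `E_p ∩ E_q` is not contained in `T`.
[this work] -/
theorem not_inter_Epet_subset {p q : Fin (k + 2)} (hp : IsPetalK k p) (hq : IsPetalK k q) (hpq : p ≠ q)
    {S T : Finset α} (hS : F.lab S = p) (hT : F.lab T = q) : ¬ (S ∩ (F.Epet p ∩ F.Epet q) ⊆ T) := by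
  intro hsub
  have h1 := F.lab_inter_Epet hp hS
  have h2 := F.lab_union_compl_Epet hq hT
  have hST : S ∩ F.Epet p ⊆ T ∪ (univ \ F.Epet q) := by
    intro x hx
    rw [mem_inter] at hx
    rw [mem_union, mem_sdiff]
    by_cases hxq : x ∈ F.Epet q
    · exact Or.inl (hsub (mem_inter.2 ⟨hx.1, mem_inter.2 ⟨hx.2, hxq⟩⟩))
    · exact Or.inr ⟨mem_univ x, hxq⟩
  rcases F.lab_mono hST with h | h | h
  · exact hpq (h1 ▸ h2 ▸ h)
  · exact hp.1 (h1 ▸ h)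
  · exact hq.2 (h2 ▸ h)

/-- Hence every `p`-set meets `E_p ∩ E_q` (class `q` non-empty). [this work] -/
theorem exists_mem_inter_Epet {p q : Fin (k + 2)} (hp : IsPetalK k p) (hq : IsPetalK k q) (hpq : p ≠ q)
    {S T : Finset α} (hS : F.lab S = p) (hT : F.lab T = q) : ∃ x ∈ S, x ∈ F.Epet p ∧ x ∈ F.Epet q := by
  obtain ⟨x, hx, -⟩ := not_subset.1 (F.not_inter_Epet_subset hp hq hpq hS hT)
  rw [mem_inter, mem_inter] at hx
  exact ⟨x, hx.1, hx.2⟩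

/-- At a point of `E_p ∩ E_q` (`p ≠ q` petals), one petal is in `Γ` and the other in `Δ`. [this work] -/
theorem Gam_Del_of_mem_inter (hr : F.Rigid) {p q : Fin (k + 2)} (hp : IsPetalK k p) (hq : IsPetalK k q)
    (hpq : p ≠ q) {x : α} (hxp : x ∈ F.Epet p) (hxq : x ∈ F.Epet q) :
    (F.Gam x p ∧ F.Del x q) ∨ (F.Del x p ∧ F.Gam x q) := by
  rw [F.mem_Epet] at hxp hxq
  rcases hxp with h1 | h1 <;> rcases hxq with h2 | h2
  · exact absurd (F.Gam_unique hr hp hq h1 h2) hpq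
  · exact Or.inl ⟨h1, h2⟩
  · exact Or.inr ⟨h1, h2⟩
  · exact absurd (F.Del_unique hr hp hq h1 h2) hpq

/-- Three-way exclusion: a point of `E_p ∩ E_q` lies in no third `E_r`. [this work] -/
theorem not_mem_Epet_third (hr : F.Rigid) {p q r : Fin (k + 2)} (hp : IsPetalK k p) (hq : IsPetalK k q)
    (hr' : IsPetalK k r) (hpq : p ≠ q) (hrp : r ≠ p) (hrq : r ≠ q) {x : α} (hxp : x ∈ F.Epet p) (hxq : x ∈ F.Epet q) :
    x ∉ F.Epet r := by
  intro hxr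
  rw [F.mem_Epet] at hxr
  rcases F.Gam_Del_of_mem_inter hr hp hq hpq hxp hxq with ⟨h1, h2⟩ | ⟨h1, h2⟩ <;> rcases hxr with h3 | h3
  · exact hrp (F.Gam_unique hr hr' hp h3 h1)
  · exact hrq (F.Del_unique hr hr' hq h3 h2)
  · exact hrq (F.Gam_unique hr hr' hq h3 h2)
  · exact hrp (F.Del_unique hr hr' hp h3 h1)

/-- **(R3) of the memo**: every `b`-set contains a point of `E_b ∩ E_c` at which `b ∈ Γ` (class `c` non-empty, `b ≠ c` petals). [this work] -/
theorem exists_mem_Gam (hr : F.Rigid) {b c : Fin (k + 2)} (hb : IsPetalK k b)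
    (hc : IsPetalK k c) (hbc : b ≠ c) {T R : Finset α} (hT : F.lab T = b) (hR : F.lab R = c) :
    ∃ x ∈ T, x ∈ F.Epet b ∧ x ∈ F.Epet c ∧ F.Gam x b := by
  classical
  set Jc : Finset α := (F.Epet b ∩ F.Epet c).filter fun x => F.Gam x c with hJc
  set Jb : Finset α := (F.Epet b ∩ F.Epet c).filter fun x => F.Gam x b with hJb
  have hR1 : F.lab (R ∪ Jc) = c := by
    refine F.lab_union_of_not_Del hc Jc R (fun x hx hD => ?_) hR
    rw [hJc, mem_filter] at hx
    exact F.Gam_Del_disjoint hr hc hx.2 hD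
  have hR2 : F.lab ((R ∪ Jc) \ Jb) = c := by
    refine F.lab_sdiff_of_not_Gam hc Jb (R ∪ Jc) (fun x hx hG => ?_) hR1
    rw [hJb, mem_filter] at hx
    exact hbc (F.Gam_unique hr hb hc hx.2 hG)
  obtain ⟨x, hx, hxR'⟩ := not_subset.1 (F.not_inter_Epet_subset hb hc hbc hT hR2)
  rw [mem_inter, mem_inter] at hx
  refine ⟨x, hx.1, hx.2.1, hx.2.2, ?_⟩
  rw [mem_sdiff, not_and, not_not] at hxR'
  by_cases hxJc : x ∈ Jc
  · have hxJb := hxR' (mem_union_right R hxJc)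
    rw [hJb, mem_filter] at hxJb
    exact hxJb.2
  · rcases F.Gam_Del_of_mem_inter hr hb hc hbc hx.2.1 hx.2.2 with ⟨h1, -⟩ | ⟨-, h2⟩
    · exact h1
    · exact absurd (mem_filter.2 ⟨mem_inter.2 ⟨hx.2.1, hx.2.2⟩, h2⟩) hxJc

/-! ### The main argument (memo §1.3) -/

/-- Core of Theorem T: in the rigid regime, a coordinate `e ∈ E_a` with `b ∈ Δ(e)` and a third non-empty petal `c` are contradictory. [this work] -/
theorem false_of_rigid_Del (hr : F.Rigid)
    {a b c : Fin (k + 2)} (ha : IsPetalK k a) (hb : IsPetalK k b) (hc : IsPetalK k c) (hab : a ≠ b) (hac : a ≠ c) (hbc : b ≠ c)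
    {e : α} (hea : e ∈ F.Epet a) (hDel : F.Del e b) {R : Finset α} (hR : F.lab R = c) : False := by
  classical
  have heb : e ∈ F.Epet b := F.mem_Epet.2 (Or.inr hDel)
  obtain ⟨T', heT', hT', hT'e⟩ := hDel
  -- an A-minimal set below T' + e
  set fam : Finset (Finset α) := (insert e T').powerset.filter fun M => F.lab M = Fin.last (k + 1) with hfam
  have hne : fam.Nonempty := ⟨insert e T', by rw [hfam, mem_filter, mem_powerset]; exact ⟨subset_refl _, hT'e⟩⟩
  obtain ⟨M₀, hM₀, hmin⟩ := exists_min_image fam Finset.card hne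
  rw [hfam, mem_filter, mem_powerset] at hM₀
  obtain ⟨hM₀T, hM₀lab⟩ := hM₀
  have heM₀ : e ∈ M₀ := by
    by_contra heM
    have hsub : M₀ ⊆ T' := fun y hy => by
      rcases mem_insert.1 (hM₀T hy) with h | h
      · exact absurd (h ▸ hy) heM
      · exact h
    rcases F.lab_mono hsub with h | h | h
    · exact hb.2 (by rw [← hT', ← h, hM₀lab])
    · rw [hM₀lab] at h; have := congrArg Fin.val h; simp at this
    · exact hb.2 (by rw [← hT', h])
  -- S := M₀ ∖ e is a b-set
  have hSsub : M₀.erase e ⊆ T' := fun y hy => by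
    rw [mem_erase] at hy
    rcases mem_insert.1 (hM₀T hy.2) with h | h
    · exact absurd h hy.1
    · exact h
  have hS : F.lab (M₀.erase e) = b := by
    rcases F.lab_mono hSsub with h | h | h
    · rw [h, hT']
    · exact absurd (by rw [insert_erase heM₀]; exact hM₀lab) (hr.noCover (M₀.erase e) e (notMem_erase e M₀) h)
    · exact absurd (hT' ▸ h) hb.2
  -- a point x of S in E_b ∩ E_c with b ∈ Γ(x)
  obtain ⟨x, hxS, hxb, hxc, hxGam⟩ := F.exists_mem_Gam hr hb hc hbc hS hR
  have hxM₀ : x ∈ M₀ := (erase_subset e M₀) hxS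
  have hxe : x ≠ e := (mem_erase.1 hxS).1
  have hxa : x ∉ F.Epet a := F.not_mem_Epet_third hr hb hc ha hbc hab hac hxb hxc
  -- M₁ := M₀ ∖ x is grey
  have hM₁top : F.lab (M₀.erase x) ≠ Fin.last (k + 1) := by
    intro h
    have hmem : M₀.erase x ∈ fam := by
      rw [hfam, mem_filter, mem_powerset]
      exact ⟨subset_trans (erase_subset x M₀) hM₀T, h⟩
    have h1 := hmin (M₀.erase x) hmem
    have h2 : (M₀.erase x).card < M₀.card := card_erase_lt_of_mem hxM₀
    omega
  have hM₁bot : F.lab (M₀.erase x) ≠ 0 := fun h =>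
    hr.noCover (M₀.erase x) x (notMem_erase x M₀) h (by rw [insert_erase hxM₀]; exact hM₀lab)
  set d := F.lab (M₀.erase x) with hd
  have hdp : IsPetalK k d := ⟨hM₁bot, hM₁top⟩
  by_cases hda : d = a
  · -- case d = a: the trace of S on E_b ∩ E_a sits inside M₁
    refine F.not_inter_Epet_subset hb ha (Ne.symm hab) hS (hd.symm.trans hda) (fun y hy => ?_)
    rw [mem_inter, mem_inter] at hy
    have hyx : y ≠ x := fun h => hxa (h ▸ hy.2.2)
    exact mem_erase.2 ⟨hyx, (erase_subset e M₀) hy.1⟩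
  by_cases hdb : d = b
  · -- case d = b: then b ∈ Δ(x), contradicting b ∈ Γ(x)
    exact F.Gam_Del_disjoint hr hb hxGam ⟨M₀.erase x, notMem_erase x M₀, hd.symm.trans hdb, by rw [insert_erase hxM₀]; exact hM₀lab⟩
  · -- case d ∉ {a, b}: e ∉ E_d, so the trace of M₁ on E_d ∩ E_b sits inside S
    have hed : e ∉ F.Epet d := F.not_mem_Epet_third hr ha hb hdp hab hda hdb hea heb
    refine F.not_inter_Epet_subset hdp hb hdb rfl hS (fun y hy => ?_)
    rw [mem_inter, mem_inter] at hy
    have hye : y ≠ e := fun h => hed (h ▸ hy.2.1)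
    exact mem_erase.2 ⟨hye, (erase_subset x M₀) hy.1⟩

/-- **Rigidity is impossible with three petals** (memo Theorem T, combinatorial half). [this work] -/
theorem false_of_rigid_three (hr : F.Rigid)
    {a b c : Fin (k + 2)} (ha : IsPetalK k a) (hb : IsPetalK k b) (hc : IsPetalK k c) (hab : a ≠ b) (hac : a ≠ c) (hbc : b ≠ c)
    {Sa Sb Sc : Finset α} (hSa : F.lab Sa = a) (hSb : F.lab Sb = b) (hSc : F.lab Sc = c) : False := by
  obtain ⟨e, -, hea, heb⟩ := F.exists_mem_inter_Epet ha hb hab hSa hSb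
  rcases F.Gam_Del_of_mem_inter hr ha hb hab hea heb with ⟨-, hD⟩ | ⟨hD, -⟩
  · exact F.false_of_rigid_Del hr ha hb hc hab hac hbc hea hD hSc
  · exact F.false_of_rigid_Del hr hb ha hc (Ne.symm hab) hbc hac heb hD hSc




/-- **THEOREM T (top-cube strictness)**: if three pairwise different petal labels are attained, the antipodal-Gladkov inequality on the full cube is
STRICT: `Σ_S kkK (lab S) (lab Sᶜ) ≥ 2` (i.e. `#{S black with white complement} ≥ 1 + #{complementary pairs of two different petals}`). [this work] -/
theorem two_le_slackTop_of_three_petals {a b c : Fin (k + 2)} (ha : IsPetalK k a) (hb : IsPetalK k b) (hc : IsPetalK k c)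
    (hab : a ≠ b) (hac : a ≠ c) (hbc : b ≠ c) {Sa Sb Sc : Finset α} (hSa : F.lab Sa = a) (hSb : F.lab Sb = b) (hSc : F.lab Sc = c) :
    2 ≤ F.slackTop := by
  by_contra h
  have hlt : F.slackTop < 2 := not_le.1 h
  exact F.false_of_rigid_three (F.rigid_of_slackTop_lt hlt) ha hb hc hab hac hbc hSa hSb hSc

/-- Theorem T for three non-empty petals `i, j, l` of an `MSunflower k α`. [this work] -/
theorem two_le_slackTop_of_three_nonempty_petals {i j l : Fin k} (hij : i ≠ j) (hil : i ≠ l) (hjl : j ≠ l)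
    {Si Sj Sl : Finset α} (hAi : Si ∉ F.A) (hVi : Si ∈ F.V i) (hAj : Sj ∉ F.A) (hVj : Sj ∈ F.V j) (hAl : Sl ∉ F.A) (hVl : Sl ∈ F.V l) :
    2 ≤ F.slackTop :=
  F.two_le_slackTop_of_three_petals ⟨petalLab_ne_zero k i, petalLab_ne_last k i⟩ ⟨petalLab_ne_zero k j, petalLab_ne_last k j⟩
    ⟨petalLab_ne_zero k l, petalLab_ne_last k l⟩
    (fun h => hij (petalLab_injective k h)) (fun h => hil (petalLab_injective k h)) (fun h => hjl (petalLab_injective k h))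
    (F.lab_eq_petalLab hAi hVi) (F.lab_eq_petalLab hAj hVj) (F.lab_eq_petalLab hAl hVl)



end MSunflower


/-- **Theorem T for a three-petal `Sunflower α`** (the `k = 3` structures of `…SunflowerPartitionLemma`): if all three petals are non-empty then
`Σ_S kk (lab S) (lab Sᶜ) ≥ 2` — strict antipodal Gladkov on the full cube. [this work] -/
theorem Sunflower.two_le_slack_of_three_petals [Fintype α] (F : Sunflower α) {S₀ S₁ S₂ : Finset α}
    (hA₀ : S₀ ∉ F.A) (hV₀ : S₀ ∈ F.V 0) (hA₁ : S₁ ∉ F.A) (hV₁ : S₁ ∈ F.V 1) (hA₂ : S₂ ∉ F.A) (hV₂ : S₂ ∈ F.V 2) :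
    2 ≤ ∑ S : Finset α, kk (F.lab S) (F.lab Sᶜ) := by
  have h := (MSunflower.ofSunflower F).two_le_slackTop_of_three_nonempty_petals (i := 0) (j := 1) (l := 2)
    (by decide) (by decide) (by decide) hA₀ hV₀ hA₁ hV₁ hA₂ hV₂
  unfold MSunflower.slackTop at h
  refine le_of_le_of_eq h (Finset.sum_congr rfl fun S _ => ?_)
  rw [MSunflower.lab_ofSunflower, MSunflower.lab_ofSunflower, kkK_three]

end Summit.CriticalPhenomena.PercolationContinuityZ3.Theorems.SunflowerPartition
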